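import Summits.ABC.ABC.Theorems.PrimePowerRadical.Negative.Orders
import Literature.NumberTheory.Sieve.DivisorBound

/-!
# `PrimePowerRadical` (stmt-ABC-1648), line `Sketch`, wave 2: the metric WDC assembly

With `W = W_p(q) = wieferichLevel q p`, `d = ord_p(q) = ordMod q p` and the renormalised `p`-adic Brjuno
atom `atom(q,p) = (W − 1)·log p / d` of the base `q` (it is `0` when `d = 0`, i.e. `p ∣ q` or `q = 0`),
we prove the ASSEMBLY step of the metric calibration of the open stub `stub_wdc` (`T_q = Σ_p atom(q,p) < ∞`):
GIVEN, for every odd prime `p` and every `Q`,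

* (i)  the order-weighted level-two count `Σ_{q<Q, W ≥ 2} 1/d ≤ τ(p−1)·(Q/p² + 1)` and
* (ii) the higher-level tail `Σ_{q<Q} (W − 2)⁺ ≤ 2Q/p² + 4p²(⌊log_p Q⌋ + 1)`

(the neighbouring stubs `stub_metric_levelTwo_of` / `stub_metric_tail_of`, taken here as hypotheses), there is
an ABSOLUTE constant `R` such that for every truncation height `x` some `S = S(x)` satisfies
`Σ_{q<Q} Σ_{p ≤ x, p odd prime} atom(q,p) ≤ R·Q + S·log Q` for all `Q ≥ 2`: the truncated renormalised
Brjuno sums have mean `≤ R + o(1)` over the bases `q < Q`, uniformly in `x`.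

Proof. Pointwise `(W − 1)/d ≤ [W ≥ 2]/d + (W − 2)⁺` (`mwdc_pointwise`); swapping the two sums, (i) and (ii)
bound the inner sum over `q` at each odd prime `p` by `log p·(τ(p−1)(Q/p²+1) + 2Q/p² + 4p²(⌊log_p Q⌋+1))`
(`mwdc_inner_le`). The `Q`-linear coefficient `log p·(τ(p−1)+2)/p²` is `≤ 4(C+2)·p^{-3/2}` by the divisor
bound `τ(n) ≤ C n^{1/4}` (`Literature.NumberTheory.Sieve.exists_card_divisors_le_mul_rpow`) and
`log p ≤ 4p^{1/4}` (`mwdc_linear_le`), a summable majorant over `ℕ`, whence `R := Σ_m 4(C+2) m^{-3/2}`;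
the rest is `≤ S·log Q` because `log p·⌊log_p Q⌋ ≤ log Q` and `1 ≤ log Q/log 2` (`mwdc_coeff_le`).

Sources: card `adelic-brjuno-summability` (crux stmt-ABC-1648, line `Sketch`, wave 2: the metric calibration
of the open stub `stub_wdc`). Deliberately NOT here: the proofs of (i) and (ii) (neighbouring stubs), any
statement about a single base `q`, and the value of `R`.
-/

noncomputable section

-- `Summit.<Summit>.<Problem>` is the mandated summit-side namespace (CONVENTIONS §2); for the
-- single-conjunct summit `ABC` the two coincide, so the duplicate `ABC.ABC` is deliberate.
set_option linter.dupNamespace false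

namespace Summit.ABC.ABC.Theorems.PrimePowerRadical.Brjuno

open Literature.NumberTheory.DiophantineGeometry UniqueFactorizationMonoid
open Summit.ABC.ABC.Theses.IneffectiveSubspace
open Summit.ABC.ABC.Theorems.PrimePowerRadical.Negative
open scoped BigOperators

/-- Pointwise comparison of the atom with the level-two indicator and the higher-level tail:
`(W − 1)·log p / d ≤ log p · ([2 ≤ W]/d + (W − 2)⁺)` (both sides vanish resp. are `≥ 0` when `d = 0`;
for `d ≥ 1` use `W − 1 ≤ [2 ≤ W] + (W − 2)⁺` in `ℕ` and `(W − 2)⁺/d ≤ (W − 2)⁺`). [folklore] -/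
theorem mwdc_pointwise (q p : ℕ) :
    ((wieferichLevel q p - 1 : ℕ) : ℝ) * Real.log p / (ordMod q p : ℝ) ≤
      Real.log p * ((if 2 ≤ wieferichLevel q p then 1 / (ordMod q p : ℝ) else 0) +
        ((wieferichLevel q p - 2 : ℕ) : ℝ)) := by
  have hlog : 0 ≤ Real.log p := Real.log_natCast_nonneg p
  rcases Nat.eq_zero_or_pos (ordMod q p) with h0 | hd
  · rw [h0, Nat.cast_zero, div_zero, div_zero, ite_self, zero_add]
    exact mul_nonneg hlog (Nat.cast_nonneg _)
  · have hd1 : (1 : ℝ) ≤ (ordMod q p : ℝ) := by exact_mod_cast hd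
    have hdpos : (0 : ℝ) < (ordMod q p : ℝ) := by linarith
    by_cases hW : 2 ≤ wieferichLevel q p
    · rw [if_pos hW]
      have hnat : (wieferichLevel q p - 1 : ℕ) = (wieferichLevel q p - 2 : ℕ) + 1 := by omega
      rw [hnat, Nat.cast_add, Nat.cast_one, div_le_iff₀ hdpos]
      have hone : (1 : ℝ) / (ordMod q p : ℝ) * (ordMod q p : ℝ) = 1 := div_mul_cancel₀ _ hdpos.ne'
      have hexp : Real.log p * (1 / (ordMod q p : ℝ) + ((wieferichLevel q p - 2 : ℕ) : ℝ)) *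
            (ordMod q p : ℝ) =
          Real.log p * (1 + ((wieferichLevel q p - 2 : ℕ) : ℝ) * (ordMod q p : ℝ)) := by
        rw [mul_assoc, add_mul, hone]
      rw [hexp]
      nlinarith [mul_nonneg hlog (Nat.cast_nonneg (α := ℝ) (wieferichLevel q p - 2)), hd1]
    · rw [if_neg hW, zero_add]
      have hnat : (wieferichLevel q p - 1 : ℕ) = 0 := by omega
      rw [hnat, Nat.cast_zero, zero_mul, zero_div]
      exact mul_nonneg hlog (Nat.cast_nonneg _)

/-- The inner sum over the bases at one prime `p`: if `Σ_{q<Q, W ≥ 2} 1/d ≤ A` and `Σ_{q<Q} (W − 2)⁺ ≤ B`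
then `Σ_{q<Q} atom(q,p) ≤ log p · (A + B)` (sum `mwdc_pointwise` over `q < Q`). [folklore] -/
theorem mwdc_inner_le {p Q : ℕ} {A B : ℝ}
    (hi : (∑ q ∈ (Finset.range Q).filter (fun q => 2 ≤ wieferichLevel q p),
      (1 : ℝ) / (ordMod q p : ℝ)) ≤ A)
    (hii : (∑ q ∈ Finset.range Q, ((wieferichLevel q p - 2 : ℕ) : ℝ)) ≤ B) :
    ∑ q ∈ Finset.range Q, ((wieferichLevel q p - 1 : ℕ) : ℝ) * Real.log p / (ordMod q p : ℝ) ≤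
      Real.log p * (A + B) := by
  have hlog : 0 ≤ Real.log p := Real.log_natCast_nonneg p
  rw [Finset.sum_filter] at hi
  calc ∑ q ∈ Finset.range Q, ((wieferichLevel q p - 1 : ℕ) : ℝ) * Real.log p / (ordMod q p : ℝ)
      ≤ ∑ q ∈ Finset.range Q, Real.log p *
          ((if 2 ≤ wieferichLevel q p then 1 / (ordMod q p : ℝ) else 0) +
            ((wieferichLevel q p - 2 : ℕ) : ℝ)) :=
        Finset.sum_le_sum fun q _ => mwdc_pointwise q p
    _ = Real.log p * ((∑ q ∈ Finset.range Q,
          (if 2 ≤ wieferichLevel q p then 1 / (ordMod q p : ℝ) else 0)) +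
            ∑ q ∈ Finset.range Q, ((wieferichLevel q p - 2 : ℕ) : ℝ)) := by
        rw [← Finset.sum_add_distrib, Finset.mul_sum]
    _ ≤ Real.log p * (A + B) := mul_le_mul_of_nonneg_left (add_le_add hi hii) hlog

/-- `log p · ⌊log_p Q⌋ ≤ log Q` for a prime `p` and `Q ≥ 1` (take logarithms in `p^{⌊log_p Q⌋} ≤ Q`). [folklore] -/
theorem mwdc_log_mul_natLog_le {p Q : ℕ} (hp : p.Prime) (hQ : Q ≠ 0) :
    Real.log p * (Nat.log p Q : ℝ) ≤ Real.log Q := by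
  have hpow : ((p ^ Nat.log p Q : ℕ) : ℝ) ≤ (Q : ℝ) := by exact_mod_cast Nat.pow_log_le_self p hQ
  have hpos : (0 : ℝ) < ((p ^ Nat.log p Q : ℕ) : ℝ) := by exact_mod_cast pow_pos hp.pos _
  have h := Real.log_le_log hpos hpow
  rw [Nat.cast_pow, Real.log_pow] at h
  rw [mul_comm]
  exact h

/-- The `Q`-linear coefficient at a prime `p` against the summable majorant: if `τ(n) ≤ C n^{1/4}` for all
`n ≥ 1` (`C ≥ 0`), then `log p · (τ(p−1) + 2)/p² ≤ 4(C+2)·p^{-3/2}` — from `τ(p−1) ≤ C p^{1/4}`,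
`2 ≤ 2 p^{1/4}` and `log p ≤ 4 p^{1/4}`. [folklore] -/
theorem mwdc_linear_le {C : ℝ} (hC0 : 0 ≤ C)
    (hC : ∀ n : ℕ, n ≠ 0 → ((n.divisors.card : ℕ) : ℝ) ≤ C * (n : ℝ) ^ (1 / 4 : ℝ))
    {p : ℕ} (hp : p.Prime) :
    Real.log p * ((((p - 1).divisors.card : ℕ) : ℝ) + 2) / (p : ℝ) ^ 2 ≤
      4 * (C + 2) * (p : ℝ) ^ (-(3 / 2 : ℝ)) := by
  have hp2 := hp.two_le
  have hpR : (2 : ℝ) ≤ p := by exact_mod_cast hp2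
  have hp0 : (0 : ℝ) < p := by linarith
  have hp1 : (1 : ℝ) ≤ p := by linarith
  have hlog0 : 0 ≤ Real.log p := Real.log_natCast_nonneg p
  -- `τ(p-1) ≤ C (p-1)^{1/4} ≤ C p^{1/4}`
  have hτ : (((p - 1).divisors.card : ℕ) : ℝ) ≤ C * (p : ℝ) ^ (1 / 4 : ℝ) := by
    have h1 := hC (p - 1) (by omega)
    have h2 : ((p - 1 : ℕ) : ℝ) ^ (1 / 4 : ℝ) ≤ (p : ℝ) ^ (1 / 4 : ℝ) :=
      Real.rpow_le_rpow (Nat.cast_nonneg _) (by exact_mod_cast Nat.sub_le p 1) (by norm_num)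
    exact h1.trans (mul_le_mul_of_nonneg_left h2 hC0)
  have hquarter : (1 : ℝ) ≤ (p : ℝ) ^ (1 / 4 : ℝ) := Real.one_le_rpow hp1 (by norm_num)
  -- `log p ≤ 4 p^{1/4}`
  have hlog : Real.log p ≤ 4 * (p : ℝ) ^ (1 / 4 : ℝ) := by
    have h := Real.log_le_rpow_div hp0.le (by norm_num : (0 : ℝ) < 1 / 4)
    calc Real.log p ≤ (p : ℝ) ^ (1 / 4 : ℝ) / (1 / 4) := h
      _ = 4 * (p : ℝ) ^ (1 / 4 : ℝ) := by ring
  -- the numerator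
  have hnum : Real.log p * ((((p - 1).divisors.card : ℕ) : ℝ) + 2) ≤
      4 * (C + 2) * ((p : ℝ) ^ (1 / 4 : ℝ) * (p : ℝ) ^ (1 / 4 : ℝ)) := by
    have hτ2 : (((p - 1).divisors.card : ℕ) : ℝ) + 2 ≤ (C + 2) * (p : ℝ) ^ (1 / 4 : ℝ) := by
      nlinarith [hτ, hquarter]
    calc Real.log p * ((((p - 1).divisors.card : ℕ) : ℝ) + 2)
        ≤ (4 * (p : ℝ) ^ (1 / 4 : ℝ)) * ((C + 2) * (p : ℝ) ^ (1 / 4 : ℝ)) :=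
          mul_le_mul hlog hτ2 (by positivity) (by positivity)
      _ = 4 * (C + 2) * ((p : ℝ) ^ (1 / 4 : ℝ) * (p : ℝ) ^ (1 / 4 : ℝ)) := by ring
  -- rpow algebra: `p^{1/4} p^{1/4} / p^2 = p^{-3/2}`
  have hsq : (p : ℝ) ^ (1 / 4 : ℝ) * (p : ℝ) ^ (1 / 4 : ℝ) = (p : ℝ) ^ (1 / 2 : ℝ) := by
    rw [← Real.rpow_add hp0]
    norm_num
  have hpow : (p : ℝ) ^ (1 / 2 : ℝ) / (p : ℝ) ^ 2 = (p : ℝ) ^ (-(3 / 2 : ℝ)) := by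
    rw [← Real.rpow_two, ← Real.rpow_sub hp0]
    norm_num
  calc Real.log p * ((((p - 1).divisors.card : ℕ) : ℝ) + 2) / (p : ℝ) ^ 2
      ≤ 4 * (C + 2) * ((p : ℝ) ^ (1 / 4 : ℝ) * (p : ℝ) ^ (1 / 4 : ℝ)) / (p : ℝ) ^ 2 :=
        div_le_div_of_nonneg_right hnum (by positivity)
    _ = 4 * (C + 2) * ((p : ℝ) ^ (1 / 2 : ℝ) / (p : ℝ) ^ 2) := by rw [hsq, mul_div_assoc]
    _ = 4 * (C + 2) * (p : ℝ) ^ (-(3 / 2 : ℝ)) := by rw [hpow]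

/-- The bound at one prime `p`, split into its `Q`-linear part and the garbage: for `Q ≥ 2`,
`log p·(τ(p−1)(Q/p²+1) + 2Q/p² + 4p²(⌊log_p Q⌋+1)) ≤ Q·4(C+2)p^{-3/2} + s_p·log Q` with
`s_p = log p(τ(p−1)+4p²)/log 2 + 4p²` (`mwdc_linear_le`, `log p·⌊log_p Q⌋ ≤ log Q`, `log 2 ≤ log Q`). [folklore] -/
theorem mwdc_coeff_le {C : ℝ} (hC0 : 0 ≤ C)
    (hC : ∀ n : ℕ, n ≠ 0 → ((n.divisors.card : ℕ) : ℝ) ≤ C * (n : ℝ) ^ (1 / 4 : ℝ))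
    {p : ℕ} (hp : p.Prime) {Q : ℕ} (hQ : 2 ≤ Q) :
    Real.log p * (((p - 1).divisors.card : ℝ) * ((Q : ℝ) / (p : ℝ) ^ 2 + 1) +
        (2 * (Q : ℝ) / (p : ℝ) ^ 2 + 4 * (p : ℝ) ^ 2 * (Nat.log p Q + 1))) ≤
      (Q : ℝ) * (4 * (C + 2) * (p : ℝ) ^ (-(3 / 2 : ℝ))) +
        (Real.log p * (((p - 1).divisors.card : ℝ) + 4 * (p : ℝ) ^ 2) / Real.log 2 +
          4 * (p : ℝ) ^ 2) * Real.log Q := by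
  have hlog0 : 0 ≤ Real.log p := Real.log_natCast_nonneg p
  have hQ0 : (0 : ℝ) ≤ Q := Nat.cast_nonneg _
  have hlog2 : 0 < Real.log 2 := Real.log_pos (by norm_num)
  have h2Q : Real.log 2 ≤ Real.log Q := Real.log_le_log two_pos (by exact_mod_cast hQ)
  have hsplit : Real.log p * (((p - 1).divisors.card : ℝ) * ((Q : ℝ) / (p : ℝ) ^ 2 + 1) +
        (2 * (Q : ℝ) / (p : ℝ) ^ 2 + 4 * (p : ℝ) ^ 2 * (Nat.log p Q + 1))) =
      (Q : ℝ) * (Real.log p * (((p - 1).divisors.card : ℝ) + 2) / (p : ℝ) ^ 2) +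
        (Real.log p * (((p - 1).divisors.card : ℝ) + 4 * (p : ℝ) ^ 2) +
          4 * (p : ℝ) ^ 2 * (Real.log p * (Nat.log p Q : ℝ))) := by
    ring
  have hlin : (Q : ℝ) * (Real.log p * (((p - 1).divisors.card : ℝ) + 2) / (p : ℝ) ^ 2) ≤
      (Q : ℝ) * (4 * (C + 2) * (p : ℝ) ^ (-(3 / 2 : ℝ))) :=
    mul_le_mul_of_nonneg_left (mwdc_linear_le hC0 hC hp) hQ0
  have hA : Real.log p * (((p - 1).divisors.card : ℝ) + 4 * (p : ℝ) ^ 2) ≤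
      Real.log p * (((p - 1).divisors.card : ℝ) + 4 * (p : ℝ) ^ 2) / Real.log 2 * Real.log Q := by
    have hA0 : 0 ≤ Real.log p * (((p - 1).divisors.card : ℝ) + 4 * (p : ℝ) ^ 2) :=
      mul_nonneg hlog0 (by positivity)
    calc Real.log p * (((p - 1).divisors.card : ℝ) + 4 * (p : ℝ) ^ 2)
        = Real.log p * (((p - 1).divisors.card : ℝ) + 4 * (p : ℝ) ^ 2) / Real.log 2 * Real.log 2 :=
          (div_mul_cancel₀ _ hlog2.ne').symm
      _ ≤ Real.log p * (((p - 1).divisors.card : ℝ) + 4 * (p : ℝ) ^ 2) / Real.log 2 * Real.log Q :=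
          mul_le_mul_of_nonneg_left h2Q (div_nonneg hA0 hlog2.le)
  have hB : 4 * (p : ℝ) ^ 2 * (Real.log p * (Nat.log p Q : ℝ)) ≤ 4 * (p : ℝ) ^ 2 * Real.log Q :=
    mul_le_mul_of_nonneg_left (mwdc_log_mul_natLog_le hp (by omega)) (by positivity)
  rw [hsplit]
  linarith [hlin, hA, hB]

/-- Summing over a finite set `P` of odd primes: GIVEN (i) and (ii) at every `p ∈ P`, for `Q ≥ 2`
`Σ_{q<Q} Σ_{p∈P} atom(q,p) ≤ Q·Σ_{p∈P} 4(C+2)p^{-3/2} + (Σ_{p∈P} s_p)·log Q` (swap the sums, then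
`mwdc_inner_le` and `mwdc_coeff_le` termwise). [folklore] -/
theorem mwdc_sum_le
    (Hi : ∀ p Q : ℕ, p.Prime → p ≠ 2 →
      (∑ q ∈ (Finset.range Q).filter (fun q => 2 ≤ wieferichLevel q p), (1 : ℝ) / (ordMod q p : ℝ)) ≤
        ((p - 1).divisors.card : ℝ) * ((Q : ℝ) / (p : ℝ) ^ 2 + 1))
    (Hii : ∀ p Q : ℕ, p.Prime → p ≠ 2 →
      (∑ q ∈ Finset.range Q, ((wieferichLevel q p - 2 : ℕ) : ℝ)) ≤
        2 * (Q : ℝ) / (p : ℝ) ^ 2 + 4 * (p : ℝ) ^ 2 * (Nat.log p Q + 1))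
    {C : ℝ} (hC0 : 0 ≤ C)
    (hC : ∀ n : ℕ, n ≠ 0 → ((n.divisors.card : ℕ) : ℝ) ≤ C * (n : ℝ) ^ (1 / 4 : ℝ))
    (P : Finset ℕ) (hP : ∀ p ∈ P, p.Prime ∧ p ≠ 2) {Q : ℕ} (hQ : 2 ≤ Q) :
    (∑ q ∈ Finset.range Q, ∑ p ∈ P,
        ((wieferichLevel q p - 1 : ℕ) : ℝ) * Real.log p / (ordMod q p : ℝ)) ≤
      (Q : ℝ) * (∑ p ∈ P, 4 * (C + 2) * (p : ℝ) ^ (-(3 / 2 : ℝ))) +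
        (∑ p ∈ P, (Real.log p * (((p - 1).divisors.card : ℝ) + 4 * (p : ℝ) ^ 2) / Real.log 2 +
          4 * (p : ℝ) ^ 2)) * Real.log Q := by
  calc (∑ q ∈ Finset.range Q, ∑ p ∈ P,
          ((wieferichLevel q p - 1 : ℕ) : ℝ) * Real.log p / (ordMod q p : ℝ))
      = ∑ p ∈ P, ∑ q ∈ Finset.range Q,
          ((wieferichLevel q p - 1 : ℕ) : ℝ) * Real.log p / (ordMod q p : ℝ) := Finset.sum_comm
    _ ≤ ∑ p ∈ P, ((Q : ℝ) * (4 * (C + 2) * (p : ℝ) ^ (-(3 / 2 : ℝ))) +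
          (Real.log p * (((p - 1).divisors.card : ℝ) + 4 * (p : ℝ) ^ 2) / Real.log 2 +
            4 * (p : ℝ) ^ 2) * Real.log Q) := by
        refine Finset.sum_le_sum fun p hp => ?_
        obtain ⟨hpr, hp2⟩ := hP p hp
        exact (mwdc_inner_le (Hi p Q hpr hp2) (Hii p Q hpr hp2)).trans (mwdc_coeff_le hC0 hC hpr hQ)
    _ = (Q : ℝ) * (∑ p ∈ P, 4 * (C + 2) * (p : ℝ) ^ (-(3 / 2 : ℝ))) +
          (∑ p ∈ P, (Real.log p * (((p - 1).divisors.card : ℝ) + 4 * (p : ℝ) ^ 2) / Real.log 2 +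
            4 * (p : ℝ) ^ 2)) * Real.log Q := by
        rw [Finset.sum_add_distrib, Finset.mul_sum, Finset.sum_mul]

/-- **stub_metric_wdc_of (assembly).** From (i) and (ii): the truncated renormalised Brjuno sums have uniformly bounded mean
over the bases — `Σ_{q<Q} Σ_{p ≤ x, p odd prime} atom(q,p) ≤ R·Q + S_x·log Q` with `R` absolute
(`R = Σ_m 4(C+2) m^{-3/2}`, `C` the constant of the divisor bound `τ(n) ≤ C n^{1/4}`). [folklore] -/
theorem stub_metric_wdc_of
    (Hi : ∀ p Q : ℕ, p.Prime → p ≠ 2 →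
      (∑ q ∈ (Finset.range Q).filter (fun q => 2 ≤ wieferichLevel q p), (1 : ℝ) / (ordMod q p : ℝ)) ≤
        ((p - 1).divisors.card : ℝ) * ((Q : ℝ) / (p : ℝ) ^ 2 + 1))
    (Hii : ∀ p Q : ℕ, p.Prime → p ≠ 2 →
      (∑ q ∈ Finset.range Q, ((wieferichLevel q p - 2 : ℕ) : ℝ)) ≤
        2 * (Q : ℝ) / (p : ℝ) ^ 2 + 4 * (p : ℝ) ^ 2 * (Nat.log p Q + 1)) :
    ∃ R : ℝ, ∀ x : ℕ, ∃ S : ℝ, ∀ Q : ℕ, 2 ≤ Q →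
      (∑ q ∈ Finset.range Q, ∑ p ∈ (Finset.range (x + 1)).filter (fun p => p.Prime ∧ p ≠ 2),
        ((wieferichLevel q p - 1 : ℕ) : ℝ) * Real.log p / (ordMod q p : ℝ)) ≤ R * Q + S * Real.log Q := by
  obtain ⟨C, hC1, hC⟩ :=
    Literature.NumberTheory.Sieve.exists_card_divisors_le_mul_rpow (by norm_num : (0 : ℝ) < 1 / 4)
  have hC0 : 0 ≤ C := by linarith
  -- the summable majorant `g m = 4(C+2) m^{-3/2}` of the `Q`-linear coefficients
  have hg0 : ∀ m : ℕ, 0 ≤ 4 * (C + 2) * (m : ℝ) ^ (-(3 / 2 : ℝ)) := fun m => by positivity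
  have hgs : Summable (fun m : ℕ => 4 * (C + 2) * (m : ℝ) ^ (-(3 / 2 : ℝ))) :=
    (Real.summable_nat_rpow.mpr (by norm_num)).mul_left (4 * (C + 2))
  refine ⟨∑' m : ℕ, 4 * (C + 2) * (m : ℝ) ^ (-(3 / 2 : ℝ)), fun x => ?_⟩
  refine ⟨∑ p ∈ (Finset.range (x + 1)).filter (fun p => p.Prime ∧ p ≠ 2),
    (Real.log p * (((p - 1).divisors.card : ℝ) + 4 * (p : ℝ) ^ 2) / Real.log 2 + 4 * (p : ℝ) ^ 2),
    fun Q hQ => ?_⟩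
  have hQ0 : (0 : ℝ) ≤ Q := Nat.cast_nonneg _
  have hPg : ∑ p ∈ (Finset.range (x + 1)).filter (fun p => p.Prime ∧ p ≠ 2),
      4 * (C + 2) * (p : ℝ) ^ (-(3 / 2 : ℝ)) ≤ ∑' m : ℕ, 4 * (C + 2) * (m : ℝ) ^ (-(3 / 2 : ℝ)) := by
    calc ∑ p ∈ (Finset.range (x + 1)).filter (fun p => p.Prime ∧ p ≠ 2),
          4 * (C + 2) * (p : ℝ) ^ (-(3 / 2 : ℝ))
        ≤ ∑ m ∈ Finset.range (x + 1), 4 * (C + 2) * (m : ℝ) ^ (-(3 / 2 : ℝ)) :=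
          Finset.sum_le_sum_of_subset_of_nonneg (Finset.filter_subset _ _) fun m _ _ => hg0 m
      _ ≤ ∑' m : ℕ, 4 * (C + 2) * (m : ℝ) ^ (-(3 / 2 : ℝ)) := hgs.sum_le_tsum _ fun m _ => hg0 m
  have hsum := mwdc_sum_le Hi Hii hC0 hC ((Finset.range (x + 1)).filter (fun p => p.Prime ∧ p ≠ 2))
    (fun p hp => (Finset.mem_filter.mp hp).2) hQ
  have hlinQ := mul_le_mul_of_nonneg_left hPg hQ0
  linarith [hsum, hlinQ]

end Summit.ABC.ABC.Theorems.PrimePowerRadical.Brjuno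

end
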